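import Mathlib
import Summits.Ventures.PercRepro.PuncturedLYMMixT4Q1Table1
import Summits.Ventures.PercRepro.PuncturedLYMMixT4Q1Table2
import Summits.Ventures.PercRepro.PuncturedLYMMixT4Q1Cols1

/-!
# PercRepro — (SP) FOR `4` PAIRWISE DISJOINT TRIPLES AND `1` PAIRWISE DISJOINT QUADRUPLES AT LEVEL `4`: THE COLUMN IDENTITIES, ASSEMBLED
(p10, gen 41)

`col_check`: the column identity of every free column class (`mass ≤ 5`, the touched bounds), by nested `interval_cases`.  Nothing here asserts (SP).
-/

namespace PercRepro.PuncturedLYM.Split.TypeLift.MixT4Q1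

/-- The column identity of every free column class, in one statement. -/
theorem col_check (n : ℚ) (hd : den n ≠ 0) (d31 d32 d41 d42 d43 : ℕ)
    (h : d31 + 2 * d32 + d41 + 2 * d42 + 3 * d43 ≤ 5) (hA : d31 + d32 ≤ 4) (hB : d41 + d42 + d43 ≤ 1) :
    1 * (d31 : ℚ) * raw n (d31 - 1) d32 d41 d42 d43 0 + 2 * (d32 : ℚ) * raw n (d31 + 1) (d32 - 1) d41 d42 d43 1 + 1 * (d41 : ℚ) * raw n d31 d32 (d41 - 1) d42 d43 3 + 2 * (d42 : ℚ) * raw n d31 d32 (d41 + 1) (d42 - 1) d43 4 + 3 * (d43 : ℚ) * raw n d31 d32 d41 (d42 + 1) (d43 - 1) 5 + ((5 : ℚ) - d31 - 2 * d32 - d41 - 2 * d42 - 3 * d43) * raw n d31 d32 d41 d42 d43 7 = 1 := by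
  have hb5 : d43 ≤ 1 := by omega
  interval_cases d43
  · have hb4 : d42 ≤ 1 := by omega
    interval_cases d42
    · have hb3 : d41 ≤ 1 := by omega
      interval_cases d41
      · have hb2 : d32 ≤ 2 := by omega
        interval_cases d32
        · have hb1 : d31 ≤ 4 := by omega
          interval_cases d31
          · push_cast
            linear_combination col_00000 n hd
          · push_cast
            linear_combination col_10000 n hd
          · push_cast
            linear_combination col_20000 n hd
          · push_cast
            linear_combination col_30000 n hd
          · push_cast
            linear_combination col_40000 n hd
        · have hb1 : d31 ≤ 3 := by omega
          interval_cases d31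
          · push_cast
            linear_combination col_01000 n hd
          · push_cast
            linear_combination col_11000 n hd
          · push_cast
            linear_combination col_21000 n hd
          · push_cast
            linear_combination col_31000 n hd
        · have hb1 : d31 ≤ 1 := by omega
          interval_cases d31
          · push_cast
            linear_combination col_02000 n hd
          · push_cast
            linear_combination col_12000 n hd
      · have hb2 : d32 ≤ 2 := by omega
        interval_cases d32
        · have hb1 : d31 ≤ 4 := by omega
          interval_cases d31
          · push_cast
            linear_combination col_00100 n hd
          · push_cast
            linear_combination col_10100 n hd
          · push_cast
            linear_combination col_20100 n hd
          · push_cast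
            linear_combination col_30100 n hd
          · push_cast
            linear_combination col_40100 n hd
        · have hb1 : d31 ≤ 2 := by omega
          interval_cases d31
          · push_cast
            linear_combination col_01100 n hd
          · push_cast
            linear_combination col_11100 n hd
          · push_cast
            linear_combination col_21100 n hd
        · have hb1 : d31 ≤ 0 := by omega
          interval_cases d31
          · push_cast
            linear_combination col_02100 n hd
    · have hb3 : d41 ≤ 0 := by omega
      interval_cases d41
      · have hb2 : d32 ≤ 1 := by omega
        interval_cases d32
        · have hb1 : d31 ≤ 3 := by omega
          interval_cases d31
          · push_cast
            linear_combination col_00010 n hd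
          · push_cast
            linear_combination col_10010 n hd
          · push_cast
            linear_combination col_20010 n hd
          · push_cast
            linear_combination col_30010 n hd
        · have hb1 : d31 ≤ 1 := by omega
          interval_cases d31
          · push_cast
            linear_combination col_01010 n hd
          · push_cast
            linear_combination col_11010 n hd
  · have hb4 : d42 ≤ 0 := by omega
    interval_cases d42
    · have hb3 : d41 ≤ 0 := by omega
      interval_cases d41
      · have hb2 : d32 ≤ 1 := by omega
        interval_cases d32
        · have hb1 : d31 ≤ 2 := by omega
          interval_cases d31
          · push_cast
            linear_combination col_00001 n hd
          · push_cast
            linear_combination col_10001 n hd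
          · push_cast
            linear_combination col_20001 n hd
        · have hb1 : d31 ≤ 0 := by omega
          interval_cases d31
          · push_cast
            linear_combination col_01001 n hd

end PercRepro.PuncturedLYM.Split.TypeLift.MixT4Q1
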